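import Summits.QuantumFields.YangMills.Theorems.LangevinControlUVOSLegsFromFemtoAndGapDefs
import Literature.MathematicalPhysics.QuantumFieldTheory.WilsonFinTorusPartition

/-!
# Thermal-descent currency for crux NT (R2a): two-point functions on the anisotropic tori `S³ × T`

Vocabulary for the line `ThermalDescent` on `BalabanLadder.NT` (stmt-QuantumFields-19353): the smeared
one- and two-point functions of the plaquette density on Wilson's anisotropic torus `S³ × T` (`Fin`-indexed
sites, time = the last factor, as in `wilsonFinTorusPartition`), and the period-doubling purity
`Z(S³×2T)/Z(S³×T)²` of the `DoublingDefect` route.  Definitions only; no statements, no proofs.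

References: M. Lüscher, Commun. Math. Phys. 54 (1977) 283 (transfer matrix); K. Osterwalder, E. Seiler,
Ann. Phys. 110 (1978) 440 (reflection positivity); I. Montvay, G. Münster, *Quantum Fields on a Lattice*
(1994) §3.2.6.
-/

noncomputable section

open scoped BigOperators
open MeasureTheory
open Literature.MathematicalPhysics.QuantumFieldTheory
open Literature.MathematicalPhysics.QuantumLattice (siteToE thetaTest)

namespace Summit.QuantumFields.YangMills.Cruxes.NT.ThermalDescent

variable (G : Type) [Group G] [TopologicalSpace G] [IsTopologicalGroup G] [CompactSpace G]
  [MeasurableSpace G] [BorelSpace G] (r : LatticeRep G)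

/-- Centred integer coordinate of `i : Fin n`, in `(-n/2, n/2]` (for `n = 2L+1` exactly `[-L, L]`, the range
of `Literature.Probability.LatticeModels.box 4 L`). [folklore] -/
def cc (n : ℕ) (i : Fin n) : ℤ := if 2 * (i : ℕ) < n then (i : ℤ) else (i : ℤ) - n

/-- Position in `ℤ⁴` of a site of the `Fin`-torus `S³ × T`, TIME FIRST: coordinate `0` is the long
(period-`T`, transfer-matrix) direction, the last factor of `FinTorusSite S S S T`. [folklore] -/
def pos {S T : ℕ} (x : FinTorusSite S S S T) : Fin 4 → ℤ :=
  ![cc T x.2.2.2, cc S x.1, cc S x.2.1, cc S x.2.2.1]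

/-- Plaquette (action) density at the site `x` of the `Fin`-torus: `Σ_{μ<ν} Re tr r(U_{x,μν})` (six
plaquettes based at `x`; the lattice `tr F²`). [cite: Wilson1974] -/
def densFT {S T : ℕ} (x : FinTorusSite S S S T) (U : FinTorusSite S S S T × Fin 4 → G) : ℝ :=
  ∑ q : {q : Fin 4 × Fin 4 // q.1 < q.2}, (r.ρ (finTorusPlaquette U x q.1.1 q.1.2)).trace.re

/-- Boltzmann weight of Wilson's action on the `Fin`-torus `S³ × T` — literally the integrand of
`wilsonFinTorusPartition r.ρ β S S S T`. [cite: MontvayMunster1994, §3.2.6 (3.145)] -/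
def weightFT (β : ℝ) {S T : ℕ} (U : FinTorusSite S S S T × Fin 4 → G) : ℝ :=
  Real.exp (-β * ∑ x : FinTorusSite S S S T, ∑ q : {q : Fin 4 × Fin 4 // q.1 < q.2},
    ((r.N : ℝ) - (r.ρ (finTorusPlaquette U x q.1.1 q.1.2)).trace.re))

/-- Expectation under Wilson's probability measure on the anisotropic torus `S³ × T`
(ratio of Haar integrals; the denominator is `wilsonFinTorusPartition`, positive by
`wilsonFinTorusPartition_pos`). [cite: MontvayMunster1994, §3.2.6] -/
def EFT (β : ℝ) (S T : ℕ) (F : (FinTorusSite S S S T × Fin 4 → G) → ℝ) : ℝ :=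
  (∫ U, F U * weightFT G r β U ∂(Measure.pi fun _ : FinTorusSite S S S T × Fin 4 => haarProbability G)) /
    wilsonFinTorusPartition r.ρ β S S S T

/-- Smeared one-point function at spacing `s` on `S³ × T`: `Σ_x f(s·pos x) ⟨A_x⟩_{S³×T}`. [folklore] -/
def Q1FT (β : ℝ) (S T : ℕ) (s : ℝ) (f : SchwartzMap (EuclideanSpace ℝ (Fin 4)) ℝ) : ℝ :=
  ∑ x : FinTorusSite S S S T, f (s • siteToE (pos x)) * EFT G r β S T (densFT G r x)

/-- Smeared truncated two-point function at spacing `s` on `S³ × T`: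
`Σ_{x,y} f(s·pos x) g(s·pos y) Cov_{S³×T}(A_x, A_y)` — the anisotropic-torus analogue of the crux currency
`DlrCollarTransfer.Q2` (same smearing, same bare normalisation, no `a⁴` factors). [folklore] -/
def Q2FT (β : ℝ) (S T : ℕ) (s : ℝ) (f g : SchwartzMap (EuclideanSpace ℝ (Fin 4)) ℝ) : ℝ :=
  ∑ x : FinTorusSite S S S T, ∑ y : FinTorusSite S S S T, f (s • siteToE (pos x)) * g (s • siteToE (pos y)) *
    (EFT G r β S T (fun U => densFT G r x U * densFT G r y U) - EFT G r β S T (densFT G r x) * EFT G r β S T (densFT G r y))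

/-- Period-doubling purity `π_β(S,T) = Z(S³×2T)/Z(S³×T)² = Tr ρ_T² ∈ (0,1]` of the thermal state at
temperature `1/T` on the spatial torus `S³` (`= 1 − δ` of the `DoublingDefect` route;
`wilsonFinTorusPartition_two_mul_le_sq`, `wilsonFinTorusPartition_pos`). [cite: Luscher1977] -/
def purity (β : ℝ) (S T : ℕ) : ℝ :=
  wilsonFinTorusPartition r.ρ β S S S (2 * T) / (wilsonFinTorusPartition r.ρ β S S S T) ^ 2

/-- The zero-temperature clause-(i) floors package for `(r, a)`: one real test function `v` supported in a
time slab `{δ₁ < y₀ < δ₂}` (`0 < δ₁`) and `ε > 0` with `ε ≤ Q2FT(θv, v)` at spacing `a(β)` on the long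
cylinders `(2L+1)³ × 2^k(2L+1)` for all `k ≥ k₀(β, L)`, every `β ≥ β₅` and every spatial size with
`Λ₅ ≤ a(β)·L`. [folklore] -/
def ZeroTempFloorsFor (a : ℝ → ℝ) : Prop :=
  ∃ (v : SchwartzMap (EuclideanSpace ℝ (Fin 4)) ℝ) (δ₁ δ₂ ε β₅ Λ₅ : ℝ), 0 < δ₁ ∧
    tsupport v ⊆ {y : EuclideanSpace ℝ (Fin 4) | δ₁ < y 0 ∧ y 0 < δ₂} ∧ 0 < ε ∧
    ∀ β : ℝ, β₅ ≤ β → ∀ L : ℕ, Λ₅ ≤ a β * L → ∃ k₀ : ℕ, ∀ k : ℕ, k₀ ≤ k →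
      ε ≤ Q2FT G r β (2 * L + 1) (2 ^ k * (2 * L + 1)) (a β) (thetaTest 4 v) v

end Summit.QuantumFields.YangMills.Cruxes.NT.ThermalDescent
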